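import Mathlib
import Literature.Analysis.FluidPDE.PassiveScalar
import Literature.Analysis.FunctionSpaces.TorusCalculusProofs
import HarnessLib

/-!
# Hess-Childs–Rowan (2025): a time-periodic `C^α` stirring field with κ-uniform (indeed
accelerating) exponential relaxation of every mean-zero `L²` scalar (Corollary 1.2), on the flat
torus `ℝ²/(√2ℤ ⊕ ℤ)` of the source

Named fact (Literature is sorry-free; users take `(h : HessChildsRowan2025_cor12)`).

Source: E. Hess-Childs, K. Rowan, *Turbulent and intermittent phenomena in a universal total
anomalous dissipator*, arXiv:2508.00115 (2025) [cite: HessChildsRowan2025b]: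

* Theorem 1.1 (Anomalous total dissipation), pp. 1–2: for all `α ∈ (0,1)`, letting
  `V ∈ L^∞([0,1], C^α(T²))` be the incompressible velocity field of Subsection 2.1 (Definition 2.5,
  eq. (2.4), Lemma 2.6, p. 14), there is `C(α) > 0` such that for all `κ ∈ (0,1)` and mean-zero
  `θ₀ ∈ TV(T²)`, the solution of `∂ₜθ - κΔθ + V·∇θ = 0`, `θ(0) = θ₀` ((1.1)) obeys
  `‖θ^κ(1,·)‖_{L¹} ≤ C κ^{(1-α)²/12} ‖θ₀‖_{TV}`.
* Corollary 1.2 (Accelerating dissipation enhancement), p. 2, proof §1.3 p. 11: extending that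
  field periodically in time to `V ∈ L^∞([0,∞), C^α(T²))`, there is `C(α) > 0` such that for all
  `κ ∈ (0,1)` and all mean-zero `θ₀ ∈ L²(T²)`, if `θ^κ` is a solution of (1.1) on `[0,∞) × T²`
  then for all `t ≥ 0`, `‖θ^κ(t,·)‖_{L²} ≤ C e^{-C⁻¹ log(κ⁻¹) (t-1)} ‖θ₀‖_{L²}`
  (per period: `‖θ(n+1+r)‖ ≤ ‖θ(n+1)‖ ≤ C κ^{(1-α)²/24} ‖θ(n)‖`, Riesz–Thorin + `L²`/`L^∞`
  contractivity + periodicity).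
* **The torus of the source.** Definition 2.1, p. 12: "`B := [0, √2] × [0, 1]` … and throughout we
  identify `T²` as `B` with periodic boundaries" (likewise the companion paper arXiv:2501.18526
  [cite: HessChildsRowan2025a], Def. 2.2, p. 7: "We let `B := [0, √2] × [0, 1]` and take `T²` to be
  `B` with opposite sides identified … as it is self-similar under being split in half"); the
  construction of the field (cells `A_n = Rⁿ B`, `R = 2^{-1/2}·rot(π/2)`, lattices `Λ_n`:
  Def. 2.1, 2.5) uses that self-similarity. So `T²` is the flat torus `ℝ²/(√2ℤ ⊕ ℤ)` with the
  isotropic diffusion `κΔ` — not the unit square torus `(ℝ/ℤ)²`. The flat tori `ℝ²/(√2ℤ ⊕ ℤ)` and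
  `ℝ²/ℤ²` are not similar (a square sublattice of `√2ℤ ⊕ ℤ`, or a sublattice of `ℤ²` similar to
  `√2ℤ ⊕ ℤ`, would force `√2 ∈ ℚ`), so no covering or rescaling carries the isotropic equation of
  one to the isotropic equation of the other.

Rendering (in the vocabulary of this tree, which has the unit torus `UnitAddTorus (Fin 2)` only).
Pull back along the group isomorphism `Φ : (ℝ/ℤ)² → ℝ²/(√2ℤ ⊕ ℤ)`, `Φ (x₀, x₁) = (√2 x₀, x₁)`.
With `θ' := θ ∘ Φ` and `V' := ((V₀ ∘ Φ)/√2, V₁ ∘ Φ)` (the push-forward of `V` under `Φ⁻¹`) one has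
`V'·∇θ' = (V·∇θ) ∘ Φ`, `div V' = (div V) ∘ Φ` (also weakly), `(Δθ) ∘ Φ = (½ ∂₀∂₀ + ∂₁∂₁) θ'`,
and means and probability-normalised `L²` norms are preserved; boundedness, spatial `α`-Hölder
continuity uniformly in time (constant `× (√2)^α`), time-periodicity and measurability of the field
are preserved. Hence Corollary 1.2 is *exactly* the unit-torus statement with "weak solution of
`∂ₜθ + V·∇θ = κΔθ`" replaced by "weak solution of `∂ₜθ + V·∇θ = κ (½ ∂₀∂₀ + ∂₁∂₁) θ`", i.e. with
the weak formulation `∫₀ᵀ ∫ θ (∂ₜψ + V·∇ψ + κ (½ ∂₀∂₀ψ + ∂₁∂₁ψ)) + ∫ θ₀ ψ(0) = 0`: the structure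
`Torus.IsWeakScalarTransportDiagOn T ![2⁻¹, 1] κ V θ₀ θ` below (`Torus.IsWeakScalarTransportOn`
with `κ Δψ ↦ κ ∑ᵢ aᵢ ∂ᵢ∂ᵢψ`; `Torus.isWeakScalarTransportDiagOn_one_iff`: `a = 1` is the
isotropic notion; `Torus.isWeakScalarTransportDiagOn_smul_iff`: scaling `a` is scaling `κ`).
The field is packaged existentially with the regularity the paper states (bounded, spatially
`α`-Hölder uniformly in time, divergence-free, `1`-periodic in time; a representative defined for
every `t`, which changes nothing for weak solutions). "A solution of (1.1)" is rendered as every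
weak solution in the DiPerna–Lions class on `[0,T)`, for every `T` — for a bounded drift and `κ > 0`
the weak solutions in `L^∞_t L²_x` of this uniformly parabolic constant-coefficient equation are
unique energy solutions (as for `κΔ`: docstring of `Torus.IsWeakScalarTransportOn.energy_ineq`), so
this is the printed statement; the bound is stated in squared form with `Torus.scalarL2Sq` and for
a.e. `t ∈ (0,T)` (weak solutions are a.e.-defined in time).

## Restated in place (verdict clean-up, 2026-08-16)

Until 2026-08-16 the body of `HessChildsRowan2025_cor12` asserted the same sentence for the
**isotropic** equation `κΔ` on the **unit square** torus (`Torus.IsWeakScalarTransportOn T κ V θ₀ θ`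
in place of `Torus.IsWeakScalarTransportDiagOn T ![2⁻¹, 1] κ V θ₀ θ`, everything else identical).
That sentence is not asserted by the source (verdict of its prove seat, 2026-08-15; re-verified
2026-08-16 against arXiv:2508.00115 pp. 2, 11, 12, 14 and arXiv:2501.18526 pp. 7, 23, see *The
torus of the source* above): it is plausible by the same method — cf. arXiv:2501.18526, App. A,
p. 23: "the proofs are easily modified to handle non-isotropic diffusions" — but treated in neither
paper. The correction fixes one constant of the statement (the diffusion matrix `diag(1,1) ↦
diag(½,1)`, i.e. the flat torus) and keeps the name, which denotes the printed corollary; the def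
had no Lean users, so nothing is rewired (the separately named `HessChildsRowan2025_cor12_sqrt2Torus`
announced in the 2026-08-15 caveat is this def). The unit-square isotropic sentence is not kept as
a declaration: it is not a published result.

Summit-side items that cite Cor. 1.2 for a relaxation clause phrased with the isotropic
`Torus.IsWeakScalarTransportOn` on `UnitAddTorus (Fin 2)` (route LimitingAbsorption of
AnomalousDissipation: `KinematicSteadySourceLaw` (stmt-AnomalousDissipation-2938) clause `(U_h)`,
`UniformRelaxationWitness` (stmt-2937), `RelaxingFamily` (stmt-15009)) are NOT instantiated
verbatim by this fact: the printed corollary supplies, on the unit torus, a field relaxing every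
mean-zero `L²` datum for the diffusion `κ (½ ∂₀∂₀ + ∂₁∂₁)` (equivalently, by
`Torus.isWeakScalarTransportDiagOn_smul_iff`, for `diag(1, 2)` at diffusivity `κ/2`); the
dissipation FLOOR `(ABS)` of those items is not covered in any case.
-/

namespace Literature.Analysis.FluidPDE

open _root_.MeasureTheory _root_.Set
open scoped NNReal ENNReal InnerProductSpace

/-! ## Weak solutions with constant diagonal diffusion (vocabulary for the corollary as printed)
-/

namespace Torus

variable {d : Type*} [Fintype d] [DecidableEq d]

/-- Weak (distributional) solutions of the passive scalar equation with a constant **diagonal**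
diffusion, `∂ₜθ + u·∇θ = κ ∑ᵢ aᵢ ∂ᵢ∂ᵢθ` on `T^d × [0,T)` with datum `θ₀`: verbatim
`Torus.IsWeakScalarTransportOn` (DiPerna–Lions 1989, §II.1, (12)–(14) with `p = q = 2` plus
viscosity: `θ ∈ L^∞_t L²_x`, `u ∈ L¹_t L²_x`, `u θ ∈ L¹_{t,x}`, `u(t)` weakly divergence free for
a.e. `t`, smooth space–time tests `Torus.IsSpaceTimeTest T ψ` possibly nonzero at `t = 0`) with
`κ Δψ` replaced by `κ ∑ᵢ aᵢ ∂ᵢ∂ᵢψ` (`Torus.partialDeriv`) in the weak formulation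
`∫₀ᵀ ∫ θ (∂ₜψ + u·∇ψ + κ ∑ᵢ aᵢ ∂ᵢ∂ᵢψ) + ∫ θ₀ ψ(0) = 0`. This is the form the isotropic
equation `∂ₜθ + u·∇θ = κΔθ` on a rectangular flat torus `ℝ^d/⊕ᵢ Lᵢℤ` takes on the unit torus
`T^d` in the coordinates `xᵢ = Lᵢ xᵢ'` (`aᵢ = Lᵢ⁻²`). [cite: DiPernaLions1989, §II.1 (12)–(14)] -/
@[mk_iff]
structure IsWeakScalarTransportDiagOn (T : ℝ) (a : d → ℝ) (κ : ℝ)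
    (u : ℝ → UnitAddTorus d → EuclideanSpace ℝ d) (θ₀ : UnitAddTorus d → ℝ)
    (θ : ℝ → UnitAddTorus d → ℝ) : Prop where
  /-- `θ` is a.e. strongly measurable on `(0,T) × T^d` (through the space–time lift). -/
  aestronglyMeasurable :
    AEStronglyMeasurable (FunctionSpaces.Torus.stLift θ) (volume.restrict (Ioo 0 T ×ˢ univ))
  /-- `u` is a.e. strongly measurable on `(0,T) × T^d` (through the space–time lift). -/
  aestronglyMeasurable_velocity :
    AEStronglyMeasurable (FunctionSpaces.Torus.stLift u) (volume.restrict (Ioo 0 T ×ˢ univ))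
  /-- `θ ∈ L^∞(0,T; L²(T^d))`: `∫ |θ(t)|² ≤ C` for a.e. `t ∈ (0,T)`. -/
  ae_lintegral_sq_le : ∃ C : ℝ≥0, ∀ᵐ t ∂(volume.restrict (Ioo 0 T)), ∫⁻ x, ‖θ t x‖ₑ ^ 2 ≤ C
  /-- `u ∈ L¹(0,T; L²(T^d))`. -/
  lintegral_velocity_lt_top :
    ∫⁻ t in Ioo 0 T, (∫⁻ x, ‖u t x‖ₑ ^ 2) ^ (1 / 2 : ℝ) < ∞
  /-- `u θ ∈ L¹((0,T) × T^d)`. -/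
  lintegral_mul_lt_top : ∫⁻ t in Ioo 0 T, ∫⁻ x, ‖u t x‖ₑ * ‖θ t x‖ₑ < ∞
  /-- `div u(t) = 0` weakly, for a.e. `t ∈ (0,T)`. -/
  ae_isWeaklyDivFree :
    ∀ᵐ t ∂(volume.restrict (Ioo 0 T)), FunctionSpaces.Torus.IsWeaklyDivFree (u t)
  /-- The weak formulation `∫₀ᵀ ∫ θ (∂ₜψ + u·∇ψ + κ ∑ᵢ aᵢ ∂ᵢ∂ᵢψ) + ∫ θ₀ ψ(0) = 0`. -/
  weak_eq : ∀ ψ : ℝ → UnitAddTorus d → ℝ, FunctionSpaces.Torus.IsSpaceTimeTest T ψ →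
    (∫ t in Ioo 0 T, ∫ x, θ t x *
        (FunctionSpaces.Torus.timeDeriv ψ t x +
            ⟪u t x, FunctionSpaces.Torus.gradient (ψ t) x⟫_ℝ +
          κ * ∑ i, a i * FunctionSpaces.Torus.partialDeriv i
            (FunctionSpaces.Torus.partialDeriv i (ψ t)) x)) +
      ∫ x, θ₀ x * ψ 0 x = 0

/-- Scaling the diffusion coefficients is scaling the diffusivity: weak solutions for `(c • a, κ)`
are exactly the weak solutions for `(a, c κ)` (the two weak formulations coincide term by term,
`κ ∑ᵢ (c aᵢ) ∂ᵢ∂ᵢψ = (c κ) ∑ᵢ aᵢ ∂ᵢ∂ᵢψ`). In particular diffusion `(½, 1)` at diffusivity `κ`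
is diffusion `(1, 2)` at diffusivity `κ/2`. [folklore] -/
theorem isWeakScalarTransportDiagOn_smul_iff {T κ : ℝ} (c : ℝ) {a : d → ℝ}
    {u : ℝ → UnitAddTorus d → EuclideanSpace ℝ d} {θ₀ : UnitAddTorus d → ℝ}
    {θ : ℝ → UnitAddTorus d → ℝ} :
    IsWeakScalarTransportDiagOn T (c • a) κ u θ₀ θ ↔
      IsWeakScalarTransportDiagOn T a (c * κ) u θ₀ θ := by
  have key : ∀ (f : UnitAddTorus d → ℝ) (x : UnitAddTorus d),
      κ * ∑ i, (c • a) i * FunctionSpaces.Torus.partialDeriv i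
          (FunctionSpaces.Torus.partialDeriv i f) x =
        c * κ * ∑ i, a i * FunctionSpaces.Torus.partialDeriv i
          (FunctionSpaces.Torus.partialDeriv i f) x := by
    intro f x
    simp only [Pi.smul_apply, smul_eq_mul, Finset.mul_sum]
    exact Finset.sum_congr rfl fun i _ => by ring
  simp only [isWeakScalarTransportDiagOn_iff, key]

/-- With all coefficients `1` the diagonal-diffusion weak solutions are exactly the weak solutions
of `Torus.IsWeakScalarTransportOn` (isotropic `κΔ`): on the smooth time slices of a space–time
test field `Δψ = ∑ᵢ ∂ᵢ∂ᵢψ` (`Torus.laplacian_eq_sum_partialDeriv_partialDeriv`), so the two weak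
formulations coincide. [folklore] -/
theorem isWeakScalarTransportDiagOn_one_iff {T κ : ℝ}
    {u : ℝ → UnitAddTorus d → EuclideanSpace ℝ d} {θ₀ : UnitAddTorus d → ℝ}
    {θ : ℝ → UnitAddTorus d → ℝ} :
    IsWeakScalarTransportDiagOn T (fun _ => 1) κ u θ₀ θ ↔ IsWeakScalarTransportOn T κ u θ₀ θ := by
  have key : ∀ ψ : ℝ → UnitAddTorus d → ℝ, FunctionSpaces.Torus.IsSpaceTimeTest T ψ →
      ∀ (t : ℝ) (x : UnitAddTorus d),
        κ * ∑ i, (fun _ : d => (1 : ℝ)) i * FunctionSpaces.Torus.partialDeriv i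
            (FunctionSpaces.Torus.partialDeriv i (ψ t)) x =
          κ * FunctionSpaces.Torus.laplacian (ψ t) x := by
    intro ψ hψ t x
    rw [FunctionSpaces.Torus.laplacian_eq_sum_partialDeriv_partialDeriv (hψ.isSmooth_slice t)]
    simp only [one_mul]
  constructor
  · rintro ⟨h₁, h₂, h₃, h₄, h₅, h₆, h₇⟩
    refine ⟨h₁, h₂, h₃, h₄, h₅, h₆, fun ψ hψ => ?_⟩
    simpa only [key ψ hψ] using h₇ ψ hψ
  · rintro ⟨h₁, h₂, h₃, h₄, h₅, h₆, h₇⟩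
    refine ⟨h₁, h₂, h₃, h₄, h₅, h₆, fun ψ hψ => ?_⟩
    simpa only [key ψ hψ] using h₇ ψ hψ

end Torus

/-! ## Corollary 1.2 as printed (flat torus `[0, √2] × [0, 1]`, in unit-torus coordinates) -/

/-- **Hess-Childs–Rowan 2025, Corollary 1.2 (accelerating dissipation enhancement)**, as printed —
on the flat torus `T² = [0, √2] × [0, 1]` with periodic boundaries (Def. 2.1, p. 12) with the
isotropic diffusion `κΔ`, written on the unit torus `(ℝ/ℤ)²` in the coordinates
`(x₀, x₁) ↦ (√2 x₀, x₁)`, where `κΔ` becomes `κ (½ ∂₀∂₀ + ∂₁∂₁)` (module docstring, *Rendering*) —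
with the field of Theorem 1.1 / Definition 2.5 packaged existentially: for every `α ∈ (0,1)` there
are a velocity field `V : ℝ → T² → ℝ²`, `1`-periodic in time on `t ≥ 0`, bounded by `A`, spatially
`α`-Hölder with constant `A` at every time, weakly divergence-free at every time, space–time
measurable (Def. 2.5, Lemma 2.6, p. 14: `V ∈ L^∞([0,1], C^α(T²))` divergence-free, extended
periodically in time), and a constant `C > 0` such that for all `κ ∈ (0,1)`, all mean-zero
`θ₀ ∈ L²(T²)` and every weak solution `θ` of `∂ₜθ + V·∇θ = κ (½ ∂₀∂₀ + ∂₁∂₁) θ`, `θ(0) = θ₀` on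
`[0,T)` (`Torus.IsWeakScalarTransportDiagOn T ![2⁻¹, 1] κ V θ₀ θ`),
`‖θ(t)‖²_{L²} ≤ (C e^{-C⁻¹ log(κ⁻¹)(t-1)})² ‖θ₀‖²_{L²}` for a.e. `t ∈ (0,T)` (printed:
`‖θ^κ(t,·)‖_{L²(T²)} ≤ C e^{-C⁻¹ log(κ⁻¹)(t-1)} ‖θ₀‖_{L²(T²)}` for all `t ∈ [0,∞)`).
Restated in place 2026-08-16 (verdict clean-up): the body previously had the isotropic
`Torus.IsWeakScalarTransportOn T κ V θ₀ θ` here, i.e. the unit-square-torus analogue, which the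
source does not assert (module docstring, *Restated in place*); name kept, no Lean users.
[cite: HessChildsRowan2025b, Cor. 1.2 (p. 2; proof §1.3, p. 11), with Thm. 1.1 (pp. 1–2), Def. 2.1 (p. 12: T² = [0,√2]×[0,1] periodic), Def. 2.5 and Lemma 2.6 (p. 14)] -/
def HessChildsRowan2025_cor12 : Prop :=
  ∀ α : ℝ≥0, 0 < α → α < 1 →
    ∃ (V : ℝ → UnitAddTorus (Fin 2) → EuclideanSpace ℝ (Fin 2)) (A : ℝ≥0) (C : ℝ), 0 < C ∧
      AEStronglyMeasurable (FunctionSpaces.Torus.stLift V) volume ∧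
      (∀ t : ℝ, 0 ≤ t → V (t + 1) = V t) ∧
      (∀ (t : ℝ) (x : UnitAddTorus (Fin 2)), ‖V t x‖ ≤ A) ∧
      (∀ t : ℝ, HolderWith A α (V t)) ∧
      (∀ t : ℝ, FunctionSpaces.Torus.IsWeaklyDivFree (V t)) ∧
      ∀ κ : ℝ, 0 < κ → κ < 1 →
        ∀ θ₀ : UnitAddTorus (Fin 2) → ℝ, MemLp θ₀ 2 volume → ∫ x, θ₀ x = 0 →
          ∀ (T : ℝ) (θ : ℝ → UnitAddTorus (Fin 2) → ℝ),
            Torus.IsWeakScalarTransportDiagOn T ![2⁻¹, 1] κ V θ₀ θ →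
              ∀ᵐ t ∂(volume.restrict (Ioo 0 T)),
                Torus.scalarL2Sq (θ t) ≤
                  (C * Real.exp (-(C⁻¹ * Real.log κ⁻¹ * (t - 1)))) ^ 2 * Torus.scalarL2Sq θ₀

#harness_tags HessChildsRowan2025_cor12

end Literature.Analysis.FluidPDE
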